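import Literature.NumberTheory.GaloisCohomology.Howard2004.TransportUnramified
import Literature.NumberTheory.GaloisCohomology.Howard2004.KolyvaginSystemReindex
import HarnessLib

/-!
# Howard 2004, §1.3/§1.4: the «change of group» along conjugation by `τ` composed with a `τ`-semilinear
# coefficient map — the global transfer `H¹(K, T) → H¹(K, T′)`, its cocycles, localizations, inverse,
# naturality and Selmer transport (theorems only)

Topic `NumberTheory/GaloisCohomology/Howard2004`. THEOREMS ONLY: no definition, no named fact, no instance, no notation,
no `sorry`.  Cell `pub/bsd-print-x9` (seat x10b-p1-w7 g12, brick «C451-CL Q4, slice 1 = GLOBAL Ψ», plan of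
`bsd-line-x10b-p1` LEAD g14 2026-08-29T14:13Z; `--supports stmt-BirchSwinnertonDyer-22642`).

SOURCE. B. Howard, *The Heegner point Kolyvagin system*, Compositio Math. **140** (2004) = arXiv:1202.6340, §1.3 (p. 7
L39–48: «The identity map on the underlying `R`-modules `T → Tw(T)` and the automorphism of `G_K` given by conjugation by `τ`
induce a "change of group" `(G_K,T) ⇝ (G_K,Tw(T))` which induces an isomorphism on cohomology `H^i(K,T) ≅ H^i(K,Tw(T))`.
Similarly at any place `v` of `K` conjugation by `τ` induces an isomorphism `H^i(K_v̄,T) ≅ H^i(K_v,Tw(T))`») and the proof of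
Thm. 1.4.2 (p0008 L144 – p0009 L4: «We denote by `φ : T → Tw(T)` the identity map on underlying groups and by `ψ` the
change of group isomorphisms `(G_K,T) → (G_K,Tw(T))`, `(G_{K_v},T) → (G_{K_v̄},Tw(T))`»).  Serre, *Galois Cohomology* I §2.4
(compatible pairs); *Corps locaux* VII §5 Prop. 3 (inner automorphisms act trivially on cohomology).

THE OBJECT.  For Howard's conjugation datum `cd` (`g^τ = cd.conj g`), discrete `Γ_K`-modules `ρ` on `M`, `ρ′` on `M′`, and
an additive `Θ : M → M′` which is `τ`-SEMILINEAR from `ρ` to `ρ′` — `Θ(ρ(g^τ) m) = ρ′(g) Θ(m)`, i.e. `Θ` is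
`Γ_K`-equivariant `Tw(ρ) → ρ′` — the compatible pair `(g ↦ g^τ, Θ)` induces an additive **transfer**
`Ψ : H¹(K, ρ) → H¹(K, ρ′)`, `[φ] ↦ [g ↦ Θ(φ(g^τ))]` (Mathlib `ContinuousCohomology.map`).  Examples: `Θ = id` (Howard's
`ψ : H¹(K,T) ≅ H¹(K,Tw T)`), `Θ = θ` of H.5(a) (the tree's `τ_*` on `H¹(K, T̄)`, `ResidualTauCohomologyProofs`), and
`Θ = ` H.4's `Tw(T) → T^∨(1)` (`DualityDatum.toTateDual`) — the DUAL-SLOT map `H¹(K, T) → H¹(K, T^∨(1))` of the class-level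
Cassels–Tate/Flach port (plan «C451-CL», brick Q4).  No definition is introduced: every statement is about an additive
`Ψ` satisfying the cocycle formula (hypothesis `hΨ`), and §1 proves such a `Ψ` EXISTS.

* §1 `exists_conjTransfer` (existence), `exists_conjTwist_cocycle` (the twisted cocycle of a cocycle).
* §2 **`conjTransfer_localization`**: at a finite place `v`, `loc_v (Ψ c) = H¹(K_v, Θ) (transport_v (loc_{σ v} c))` with
  Howard's local transport `cd.transportH1 ρ v : H¹(K_{σ v}, T) → H¹(K_v, Tw T)` (the inner correction `δ_v` is a coboundary).
* §3 `conjTransfer_conjTransfer` (two transfers compose to `H¹` of the EQUIVARIANT composite `Θ′ ∘ Θ`),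
  **`conjTransfer_bijective`** (inverse coefficient maps ⇒ `Ψ` bijective).
* §4 **`conjTransfer_cohomologyMap`** (naturality: `Ψ₂ ∘ H¹(a) = H¹(a′) ∘ Ψ₁` when `Θ₂ ∘ a = a′ ∘ Θ₁`; scalars, `inc`, `red`).
* §5 **`conjTransfer_mem_selmerGroup`** (Selmer transport: if `H¹(K_v, Θ) ∘ transport_v` carries `𝓕_{σ v}` into `𝓕′_v`
  at the finite places and `𝓕′` is everything at the infinite ones, `Ψ(H¹_𝓕(K, ρ)) ⊆ H¹_{𝓕′}(K, ρ′)`).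

HONEST FRAMING: generic Galois-cohomology plumbing; no duality statement, no pairing, no summit statement is proved; the
Birch–Swinnerton-Dyer conjecture is not proved by any of this.
-/

set_option autoImplicit false

noncomputable section

open Function NumberField IsDedekindDomain Field CategoryTheory
open scoped NumberField

namespace Literature.NumberTheory.GaloisCohomology.Howard2004

open Literature.NumberTheory.GaloisRepresentations
open Literature.NumberTheory.GaloisRepresentations.DiscreteGaloisModule

variable {K : Type} [Field K] [NumberField K]
  {M : Type} [AddCommGroup M] [TopologicalSpace M] [DiscreteTopology M]
  {M' : Type} [AddCommGroup M'] [TopologicalSpace M'] [DiscreteTopology M']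
  {M'' : Type} [AddCommGroup M''] [TopologicalSpace M''] [DiscreteTopology M'']

/-! ## §0 Cocycle folklore -/

/-- `(g^τ)^τ = g` for the involutive lift `τ` of a conjugation datum. [folklore] -/
private theorem conj_conj (cd : ConjugationDatum K) (g : absoluteGaloisGroup K) :
    cd.conj (cd.conj g) = g := by
  have hinv : ∀ x, cd.τ (cd.τ x) = x := cd.involutive
  have hsymm : ∀ y, cd.τ.symm y = cd.τ y := fun y => by
    apply cd.τ.injective; rw [RingEquiv.apply_symm_apply, hinv]
  apply AlgEquiv.ext
  intro x
  change cd.τ.symm (cd.τ.symm ((show AlgebraicClosure K ≃ₐ[K] AlgebraicClosure K from g)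
    (cd.τ (cd.τ x)))) = (show AlgebraicClosure K ≃ₐ[K] AlgebraicClosure K from g) x
  rw [hinv, hsymm, hsymm, hinv]

/-- Two continuous crossed homomorphisms that differ by a coboundary have the same class. [folklore] -/
private theorem oneCocycleClass_eq_of_forall_sub_eq {G : Type} [Group G] [TopologicalSpace G]
    [IsTopologicalGroup G] {Y : TopRep ℤ G} (a b : contOneCocycles Y) (m : Y)
    (h : ∀ g, a.1 g - b.1 g = Y.ρ g m - m) : oneCocycleClass Y a = oneCocycleClass Y b := by
  rw [← sub_eq_zero, ← oneCocycleClass_sub, oneCocycleClass_eq_zero_iff]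
  exact ⟨m, fun g => by rw [Submodule.coe_sub, ContinuousMap.sub_apply]; exact h g⟩

omit [NumberField K] in
/-- Cocycle identity `f(δ z δ⁻¹) = f(δ) + δ·f(z) − (δ z δ⁻¹)·f(δ)`. [folklore] -/
private theorem cocycle_apply_conj {ρ : DiscreteGaloisModule K M} (f : contOneCocycles ρ.toTopRep)
    (δ z : absoluteGaloisGroup K) :
    f.1 (δ * z * δ⁻¹) = f.1 δ + ρ δ (f.1 z) - ρ (δ * z * δ⁻¹) (f.1 δ) := by
  have e1 : f.1 (δ * z * δ⁻¹ * δ) = f.1 (δ * z * δ⁻¹) + ρ (δ * z * δ⁻¹) (f.1 δ) := by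
    rw [(mem_contOneCocycles_iff f.1).mp f.2 (δ * z * δ⁻¹) δ, ContinuousRep.toTopRep_ρ_apply]
  have e2 : f.1 (δ * z * δ⁻¹ * δ) = f.1 δ + ρ δ (f.1 z) := by
    rw [inv_mul_cancel_right, (mem_contOneCocycles_iff f.1).mp f.2 δ z, ContinuousRep.toTopRep_ρ_apply]
  rw [e2] at e1
  exact eq_sub_of_add_eq e1.symm

/-! ## §1 Existence of the transfer and of twisted cocycles -/

/-- **The twisted cocycle**: for a continuous crossed homomorphism `φ : Γ_K → M` of `ρ` and a `τ`-semilinear `Θ`,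
`g ↦ Θ(φ(g^τ))` is a continuous crossed homomorphism of `ρ′` (the pull-back along the compatible pair `(g ↦ g^τ, Θ)`).
[cite: Howard2004HeegnerKolyvagin, §1.3 (arXiv:1202.6340 p. 7 L39–46)] [cite: SerreGaloisCohomology1997, I §2.4 (compatible pairs)] -/
theorem exists_conjTwist_cocycle (cd : ConjugationDatum K) (ρ : DiscreteGaloisModule K M)
    (ρ' : DiscreteGaloisModule K M') (Θ : M →+ M')
    (hΘ : ∀ (g : absoluteGaloisGroup K) (m : M), Θ (ρ (cd.conj g) m) = ρ' g (Θ m))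
    (φ : contOneCocycles ρ.toTopRep) :
    ∃ ψ : contOneCocycles ρ'.toTopRep, ∀ g, ψ.1 g = Θ (φ.1 (cd.conj g)) :=
  ⟨contOneCocycles.pullback cd.conj (X := ρ.toTopRep) (Y := ρ'.toTopRep)
      (TopRep.ofHom ⟨⟨Θ.toIntLinearMap, continuous_of_discreteTopology⟩,
        fun g => ContinuousLinearMap.ext fun m => hΘ g m⟩) φ,
    fun _ => rfl⟩

/-- **THE TRANSFER EXISTS**: there is an additive `Ψ : H¹(K, ρ) → H¹(K, ρ′)` with `Ψ [φ] = [g ↦ Θ(φ(g^τ))]` for every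
continuous crossed homomorphism `φ` (Howard's change of group `ψ` followed by the coefficient map `Θ`; Mathlib's
`ContinuousCohomology.map` along the compatible pair).  Everything below is stated for any additive `Ψ` with this cocycle
formula. [cite: Howard2004HeegnerKolyvagin, §1.3 and the proof of Thm. 1.4.2 (arXiv:1202.6340 p. 7 L39–46, p0008 L144 – p0009 L4)]
[cite: SerreGaloisCohomology1997, I §2.4 (compatible pairs)] -/
theorem exists_conjTransfer (cd : ConjugationDatum K) (ρ : DiscreteGaloisModule K M)
    (ρ' : DiscreteGaloisModule K M') (Θ : M →+ M')
    (hΘ : ∀ (g : absoluteGaloisGroup K) (m : M), Θ (ρ (cd.conj g) m) = ρ' g (Θ m)) :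
    ∃ Ψ : galoisCohomology ρ 1 →+ galoisCohomology ρ' 1,
      ∀ (φ : contOneCocycles ρ.toTopRep) (ψ : contOneCocycles ρ'.toTopRep),
        (∀ g, ψ.1 g = Θ (φ.1 (cd.conj g))) → Ψ (oneCocycleClass _ φ) = oneCocycleClass _ ψ := by
  let f : TopRep.res (cd.conj : absoluteGaloisGroup K →* absoluteGaloisGroup K) ρ.toTopRep ⟶ ρ'.toTopRep :=
    TopRep.ofHom ⟨⟨Θ.toIntLinearMap, continuous_of_discreteTopology⟩,
      fun g => ContinuousLinearMap.ext fun m => hΘ g m⟩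
  let Ψ : galoisCohomology ρ 1 →+ galoisCohomology ρ' 1 :=
    (ContinuousCohomology.map cd.conj f 1).hom.toLinearMap.toAddMonoidHom
  refine ⟨Ψ, fun φ ψ hψ => ?_⟩
  have h : Ψ (oneCocycleClass _ φ) = oneCocycleClass _ (contOneCocycles.pullback cd.conj f φ) :=
    map_oneCocycleClass _ _ _ φ
  rw [h]
  congr 1
  exact Subtype.ext (ContinuousMap.ext fun g => (hψ g).symm)

/-! ## §2 Localization: `loc_v ∘ Ψ = H¹(K_v, Θ) ∘ transport_v ∘ loc_{σ v}` -/

/-- A `τ`-semilinear `Θ : ρ ⇝ ρ′` is `Γ_K`-EQUIVARIANT from `Tw(ρ)` to `ρ′` (by definition of `Tw`).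
[cite: Howard2004HeegnerKolyvagin, §1.3 (arXiv:1202.6340 p. 7 L39–41)] -/
theorem twist_semilinear_equivariant (cd : ConjugationDatum K) (ρ : DiscreteGaloisModule K M)
    (ρ' : DiscreteGaloisModule K M') (Θ : M →+ M')
    (hΘ : ∀ (g : absoluteGaloisGroup K) (m : M), Θ (ρ (cd.conj g) m) = ρ' g (Θ m))
    (g : absoluteGaloisGroup K) (m : M) : Θ (cd.twist ρ g m) = ρ' g (Θ m) := by
  rw [ConjugationDatum.twist_apply]; exact hΘ g m

/-- The same on the local modules at a place `v`. [cite: Howard2004HeegnerKolyvagin, §1.3 (arXiv:1202.6340 p. 7 L44–48)] -/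
theorem twist_semilinear_equivariant_toLocal (cd : ConjugationDatum K) (ρ : DiscreteGaloisModule K M)
    (ρ' : DiscreteGaloisModule K M') (Θ : M →+ M')
    (hΘ : ∀ (g : absoluteGaloisGroup K) (m : M), Θ (ρ (cd.conj g) m) = ρ' g (Θ m))
    (v : Place K) (g : absoluteGaloisGroup (Place.Completion v)) (m : M) :
    Θ (((cd.twist ρ).toLocal v) g m) = (ρ'.toLocal v) g (Θ m) :=
  twist_semilinear_equivariant cd ρ ρ' Θ hΘ _ m

/-- **`loc_v (Ψ c) = H¹(K_v, Θ) (transport_v (loc_{σ v} c))`** at every finite place `v`: localizing the transfer at `v` is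
Howard's local transport `H¹(K_{σ v}, T) → H¹(K_v, Tw T)` of the localization at `σ v = v̄`, followed by the coefficient map
`Θ : Tw(T) → T′` on `H¹(K_v, ·)`; the inner correction `δ_v` of the datum (`τ⁻¹ res_v(g) τ = δ_v res_v̄(φ_v g) δ_v⁻¹`)
changes the cocycle by the coboundary of `Θ(f(δ_v))`.
[cite: Howard2004HeegnerKolyvagin, §1.3 (arXiv:1202.6340 p. 7 L44–48) and the proof of Thm. 1.4.2 (p0008 L144 – p0009 L4)]
[cite: SerreLocalFields1979, VII §5 Prop. 3] -/
theorem conjTransfer_localization (cd : ConjugationDatum K) (ρ : DiscreteGaloisModule K M)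
    (ρ' : DiscreteGaloisModule K M') (Θ : M →+ M')
    (hΘ : ∀ (g : absoluteGaloisGroup K) (m : M), Θ (ρ (cd.conj g) m) = ρ' g (Θ m))
    (Ψ : galoisCohomology ρ 1 →+ galoisCohomology ρ' 1)
    (hΨ : ∀ (φ : contOneCocycles ρ.toTopRep) (ψ : contOneCocycles ρ'.toTopRep),
      (∀ g, ψ.1 g = Θ (φ.1 (cd.conj g))) → Ψ (oneCocycleClass _ φ) = oneCocycleClass _ ψ)
    (v : HeightOneSpectrum (𝓞 K)) (c : galoisCohomology ρ 1) :
    galoisCohomology.localization ρ' (Sum.inr v) 1 (Ψ c) =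
      ContinuousRep.cohomologyMap ((cd.twist ρ).toLocal (Sum.inr v)) (ρ'.toLocal (Sum.inr v)) Θ
        continuous_of_discreteTopology (twist_semilinear_equivariant_toLocal cd ρ ρ' Θ hΘ (Sum.inr v)) 1
        (cd.transportH1 ρ v (galoisCohomology.localization ρ (Sum.inr (cd.σ • v)) 1 c)) := by
  obtain ⟨f, rfl⟩ := oneCocycleClass_surjective ρ.toTopRep c
  obtain ⟨ψ, hψ⟩ := exists_conjTwist_cocycle cd ρ ρ' Θ hΘ f
  rw [hΨ f ψ hψ]
  -- localizing a class: `loc_w [χ] = [χ ∘ res_w]`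
  have hloc : ∀ {M₀ : Type} [AddCommGroup M₀] [TopologicalSpace M₀] [DiscreteTopology M₀]
      (ρ₀ : DiscreteGaloisModule K M₀) (w : HeightOneSpectrum (𝓞 K)) (χ : contOneCocycles ρ₀.toTopRep),
      galoisCohomology.localization ρ₀ (Sum.inr w) 1 (oneCocycleClass _ χ) =
        oneCocycleClass (ρ₀.toLocal (Sum.inr w)).toTopRep
          (contOneCocycles.pullback (absGaloisRestrict K (Place.Completion (Sum.inr w)))
            (X := ρ₀.toTopRep) (Y := (ρ₀.toLocal (Sum.inr w)).toTopRep)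
            (TopRep.ofHom ⟨ContinuousLinearMap.id ℤ M₀, fun _ => rfl⟩) χ) :=
    fun ρ₀ w χ => map_oneCocycleClass _ _ _ χ
  -- `H¹(K_v, Θ)` on a class: `[χ] ↦ [Θ ∘ χ]`
  have hΘv : ∀ χ : contOneCocycles ((cd.twist ρ).toLocal (Sum.inr v)).toTopRep,
      ContinuousRep.cohomologyMap ((cd.twist ρ).toLocal (Sum.inr v)) (ρ'.toLocal (Sum.inr v)) Θ
          continuous_of_discreteTopology (twist_semilinear_equivariant_toLocal cd ρ ρ' Θ hΘ (Sum.inr v)) 1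
          (oneCocycleClass _ χ) =
        oneCocycleClass _ (contOneCocycles.pullback (ContinuousMonoidHom.id _)
          (X := ((cd.twist ρ).toLocal (Sum.inr v)).toTopRep) (Y := (ρ'.toLocal (Sum.inr v)).toTopRep)
          (TopRep.ofHom ⟨⟨Θ.toIntLinearMap, continuous_of_discreteTopology⟩,
            fun g => ContinuousLinearMap.ext fun x =>
              twist_semilinear_equivariant_toLocal cd ρ ρ' Θ hΘ (Sum.inr v) g x⟩) χ) :=
    fun χ => map_oneCocycleClass _ _ _ χ
  rw [hloc, hloc, ConjugationDatum.transportH1_oneCocycleClass]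
  refine Eq.trans ?_ (hΘv _).symm
  refine oneCocycleClass_eq_of_forall_sub_eq _ _ (-(Θ (f.1 (cd.δ v)))) fun g => ?_
  change ψ.1 (absGaloisRestrict K (v.adicCompletion K) g) -
      Θ (ρ (cd.δ v) (f.1 (absGaloisRestrict K ((cd.σ • v).adicCompletion K) (cd.φ v g)))) =
    ρ' (absGaloisRestrict K (v.adicCompletion K) g) (-(Θ (f.1 (cd.δ v)))) - -(Θ (f.1 (cd.δ v)))
  rw [hψ, ConjugationDatum.conj_absGaloisRestrict_eq, cocycle_apply_conj,
    ← ConjugationDatum.conj_absGaloisRestrict_eq, map_sub, map_add, hΘ, map_neg]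
  abel

/-! ## §3 Composition of transfers; bijectivity -/

/-- The composite `Θ′ ∘ Θ` of two `τ`-semilinear maps `ρ ⇝ ρ′ ⇝ ρ″` is `Γ_K`-EQUIVARIANT `ρ → ρ″` (`(g^τ)^τ = g`: two
changes of group along `τ` compose to the identity change of group). [cite: Howard2004HeegnerKolyvagin, §1.3 (arXiv:1202.6340 p. 7 L39–46)] [cite: SerreGaloisCohomology1997, I §2.4 (compatible pairs)] -/
theorem comp_semilinear_equivariant (cd : ConjugationDatum K) (ρ : DiscreteGaloisModule K M)
    (ρ' : DiscreteGaloisModule K M') (ρ'' : DiscreteGaloisModule K M'') (Θ : M →+ M') (Θ' : M' →+ M'')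
    (hΘ : ∀ (g : absoluteGaloisGroup K) (m : M), Θ (ρ (cd.conj g) m) = ρ' g (Θ m))
    (hΘ' : ∀ (g : absoluteGaloisGroup K) (m : M'), Θ' (ρ' (cd.conj g) m) = ρ'' g (Θ' m))
    (g : absoluteGaloisGroup K) (m : M) : (Θ'.comp Θ) (ρ g m) = ρ'' g ((Θ'.comp Θ) m) := by
  rw [AddMonoidHom.comp_apply, AddMonoidHom.comp_apply, ← hΘ', ← hΘ, conj_conj]

/-- **Two transfers compose to `H¹` of the equivariant composite**: `Ψ′ (Ψ c) = H¹(Θ′ ∘ Θ) c`.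
[cite: Howard2004HeegnerKolyvagin, §1.3 (arXiv:1202.6340 p. 7 L39–46)] [cite: SerreGaloisCohomology1997, I §2.4] -/
theorem conjTransfer_conjTransfer (cd : ConjugationDatum K) (ρ : DiscreteGaloisModule K M)
    (ρ' : DiscreteGaloisModule K M') (ρ'' : DiscreteGaloisModule K M'') (Θ : M →+ M') (Θ' : M' →+ M'')
    (hΘ : ∀ (g : absoluteGaloisGroup K) (m : M), Θ (ρ (cd.conj g) m) = ρ' g (Θ m))
    (hΘ' : ∀ (g : absoluteGaloisGroup K) (m : M'), Θ' (ρ' (cd.conj g) m) = ρ'' g (Θ' m))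
    (Ψ : galoisCohomology ρ 1 →+ galoisCohomology ρ' 1)
    (hΨ : ∀ (φ : contOneCocycles ρ.toTopRep) (ψ : contOneCocycles ρ'.toTopRep),
      (∀ g, ψ.1 g = Θ (φ.1 (cd.conj g))) → Ψ (oneCocycleClass _ φ) = oneCocycleClass _ ψ)
    (Ψ' : galoisCohomology ρ' 1 →+ galoisCohomology ρ'' 1)
    (hΨ' : ∀ (φ : contOneCocycles ρ'.toTopRep) (ψ : contOneCocycles ρ''.toTopRep),
      (∀ g, ψ.1 g = Θ' (φ.1 (cd.conj g))) → Ψ' (oneCocycleClass _ φ) = oneCocycleClass _ ψ)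
    (c : galoisCohomology ρ 1) :
    Ψ' (Ψ c) = ContinuousRep.cohomologyMap ρ ρ'' (Θ'.comp Θ) continuous_of_discreteTopology
      (comp_semilinear_equivariant cd ρ ρ' ρ'' Θ Θ' hΘ hΘ') 1 c := by
  obtain ⟨f, rfl⟩ := oneCocycleClass_surjective ρ.toTopRep c
  obtain ⟨ψ, hψ⟩ := exists_conjTwist_cocycle cd ρ ρ' Θ hΘ f
  obtain ⟨χ, hχ⟩ := exists_conjTwist_cocycle cd ρ' ρ'' Θ' hΘ' ψ
  rw [hΨ f ψ hψ, hΨ' ψ χ hχ, cohomologyMap_one_oneCocycleClass]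
  congr 1
  refine Subtype.ext (ContinuousMap.ext fun g => ?_)
  rw [hχ, hψ, conj_conj]
  rfl

/-- **Inverse coefficient maps give inverse transfers**: if `Θ′ ∘ Θ = id` then `Ψ′ ∘ Ψ = id`.
[cite: Howard2004HeegnerKolyvagin, §1.3 («induces an isomorphism on cohomology», arXiv:1202.6340 p. 7 L44–46)] -/
theorem conjTransfer_conjTransfer_eq_self (cd : ConjugationDatum K) (ρ : DiscreteGaloisModule K M)
    (ρ' : DiscreteGaloisModule K M') (Θ : M →+ M') (Θ' : M' →+ M)
    (hΘ : ∀ (g : absoluteGaloisGroup K) (m : M), Θ (ρ (cd.conj g) m) = ρ' g (Θ m))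
    (hΘ' : ∀ (g : absoluteGaloisGroup K) (m : M'), Θ' (ρ' (cd.conj g) m) = ρ g (Θ' m))
    (hinv : ∀ m, Θ' (Θ m) = m)
    (Ψ : galoisCohomology ρ 1 →+ galoisCohomology ρ' 1)
    (hΨ : ∀ (φ : contOneCocycles ρ.toTopRep) (ψ : contOneCocycles ρ'.toTopRep),
      (∀ g, ψ.1 g = Θ (φ.1 (cd.conj g))) → Ψ (oneCocycleClass _ φ) = oneCocycleClass _ ψ)
    (Ψ' : galoisCohomology ρ' 1 →+ galoisCohomology ρ 1)
    (hΨ' : ∀ (φ : contOneCocycles ρ'.toTopRep) (ψ : contOneCocycles ρ.toTopRep),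
      (∀ g, ψ.1 g = Θ' (φ.1 (cd.conj g))) → Ψ' (oneCocycleClass _ φ) = oneCocycleClass _ ψ)
    (c : galoisCohomology ρ 1) : Ψ' (Ψ c) = c := by
  rw [conjTransfer_conjTransfer cd ρ ρ' ρ Θ Θ' hΘ hΘ' Ψ hΨ Ψ' hΨ' c]
  exact cohomologyMap_one_id_apply ρ (Θ'.comp Θ) (comp_semilinear_equivariant cd ρ ρ' ρ Θ Θ' hΘ hΘ')
    (fun m => hinv m) c

/-- **The transfer is BIJECTIVE when `Θ` has a two-sided `τ`-semilinear inverse** (Howard: «induces an isomorphism on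
cohomology»). [cite: Howard2004HeegnerKolyvagin, §1.3 (arXiv:1202.6340 p. 7 L44–46)] -/
theorem conjTransfer_bijective (cd : ConjugationDatum K) (ρ : DiscreteGaloisModule K M)
    (ρ' : DiscreteGaloisModule K M') (Θ : M →+ M') (Θ' : M' →+ M)
    (hΘ : ∀ (g : absoluteGaloisGroup K) (m : M), Θ (ρ (cd.conj g) m) = ρ' g (Θ m))
    (hΘ' : ∀ (g : absoluteGaloisGroup K) (m : M'), Θ' (ρ' (cd.conj g) m) = ρ g (Θ' m))
    (hinv : ∀ m, Θ' (Θ m) = m) (hinv' : ∀ m', Θ (Θ' m') = m')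
    (Ψ : galoisCohomology ρ 1 →+ galoisCohomology ρ' 1)
    (hΨ : ∀ (φ : contOneCocycles ρ.toTopRep) (ψ : contOneCocycles ρ'.toTopRep),
      (∀ g, ψ.1 g = Θ (φ.1 (cd.conj g))) → Ψ (oneCocycleClass _ φ) = oneCocycleClass _ ψ)
    (Ψ' : galoisCohomology ρ' 1 →+ galoisCohomology ρ 1)
    (hΨ' : ∀ (φ : contOneCocycles ρ'.toTopRep) (ψ : contOneCocycles ρ.toTopRep),
      (∀ g, ψ.1 g = Θ' (φ.1 (cd.conj g))) → Ψ' (oneCocycleClass _ φ) = oneCocycleClass _ ψ) :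
    Function.Bijective Ψ := by
  refine Function.bijective_iff_has_inverse.mpr ⟨Ψ', fun c => ?_, fun c' => ?_⟩
  · exact conjTransfer_conjTransfer_eq_self cd ρ ρ' Θ Θ' hΘ hΘ' hinv Ψ hΨ Ψ' hΨ' c
  · exact conjTransfer_conjTransfer_eq_self cd ρ' ρ Θ' Θ hΘ' hΘ hinv' Ψ' hΨ' Ψ hΨ c'

/-! ## §4 Naturality in the modules (scalars, `inc`, `red`) -/

/-- **Naturality of the transfer**: for `Γ_K`-equivariant `a : ρ₁ → ρ₂`, `a′ : ρ₁′ → ρ₂′` and `τ`-semilinear `Θ₁ : ρ₁ ⇝ ρ₁′`,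
`Θ₂ : ρ₂ ⇝ ρ₂′` with `Θ₂ ∘ a = a′ ∘ Θ₁`, the transfers satisfy `Ψ₂ (H¹(a) c) = H¹(a′) (Ψ₁ c)` (both are
`[g ↦ Θ₂(a(φ(g^τ)))] = [g ↦ a′(Θ₁(φ(g^τ)))]`).  Instances: the scalars `H¹(r•)` (Ψ is `R`-semilinear for the actions
intertwined by `Θ`), the tower maps `H¹(inc)`, `H¹(red)`.
[cite: Howard2004HeegnerKolyvagin, §1.3 (arXiv:1202.6340 p. 7 L39–46)] [cite: SerreGaloisCohomology1997, I §2.2 and §2.4] -/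
theorem conjTransfer_cohomologyMap (cd : ConjugationDatum K)
    {M₁ : Type} [AddCommGroup M₁] [TopologicalSpace M₁] [DiscreteTopology M₁]
    {M₂ : Type} [AddCommGroup M₂] [TopologicalSpace M₂] [DiscreteTopology M₂]
    {M₁' : Type} [AddCommGroup M₁'] [TopologicalSpace M₁'] [DiscreteTopology M₁']
    {M₂' : Type} [AddCommGroup M₂'] [TopologicalSpace M₂'] [DiscreteTopology M₂']
    (ρ₁ : DiscreteGaloisModule K M₁) (ρ₂ : DiscreteGaloisModule K M₂)
    (ρ₁' : DiscreteGaloisModule K M₁') (ρ₂' : DiscreteGaloisModule K M₂')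
    (a : M₁ →+ M₂) (ha : ∀ (g : absoluteGaloisGroup K) (x : M₁), a (ρ₁ g x) = ρ₂ g (a x))
    (a' : M₁' →+ M₂') (ha' : ∀ (g : absoluteGaloisGroup K) (x : M₁'), a' (ρ₁' g x) = ρ₂' g (a' x))
    (Θ₁ : M₁ →+ M₁') (hΘ₁ : ∀ (g : absoluteGaloisGroup K) (m : M₁), Θ₁ (ρ₁ (cd.conj g) m) = ρ₁' g (Θ₁ m))
    (Θ₂ : M₂ →+ M₂') (hΘ₂ : ∀ (g : absoluteGaloisGroup K) (m : M₂), Θ₂ (ρ₂ (cd.conj g) m) = ρ₂' g (Θ₂ m))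
    (hcomm : ∀ x, Θ₂ (a x) = a' (Θ₁ x))
    (Ψ₁ : galoisCohomology ρ₁ 1 →+ galoisCohomology ρ₁' 1)
    (hΨ₁ : ∀ (φ : contOneCocycles ρ₁.toTopRep) (ψ : contOneCocycles ρ₁'.toTopRep),
      (∀ g, ψ.1 g = Θ₁ (φ.1 (cd.conj g))) → Ψ₁ (oneCocycleClass _ φ) = oneCocycleClass _ ψ)
    (Ψ₂ : galoisCohomology ρ₂ 1 →+ galoisCohomology ρ₂' 1)
    (hΨ₂ : ∀ (φ : contOneCocycles ρ₂.toTopRep) (ψ : contOneCocycles ρ₂'.toTopRep),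
      (∀ g, ψ.1 g = Θ₂ (φ.1 (cd.conj g))) → Ψ₂ (oneCocycleClass _ φ) = oneCocycleClass _ ψ)
    (c : galoisCohomology ρ₁ 1) :
    Ψ₂ (ContinuousRep.cohomologyMap ρ₁ ρ₂ a continuous_of_discreteTopology ha 1 c) =
      ContinuousRep.cohomologyMap ρ₁' ρ₂' a' continuous_of_discreteTopology ha' 1 (Ψ₁ c) := by
  obtain ⟨f, rfl⟩ := oneCocycleClass_surjective ρ₁.toTopRep c
  obtain ⟨ψ, hψ⟩ := exists_conjTwist_cocycle cd ρ₁ ρ₁' Θ₁ hΘ₁ f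
  rw [hΨ₁ f ψ hψ, cohomologyMap_one_oneCocycleClass, cohomologyMap_one_oneCocycleClass]
  obtain ⟨χ, hχ⟩ := exists_conjTwist_cocycle cd ρ₂ ρ₂' Θ₂ hΘ₂
    (contOneCocycles.pullback (ContinuousMonoidHom.id (absoluteGaloisGroup K)) (X := ρ₁.toTopRep) (Y := ρ₂.toTopRep)
      (TopRep.ofHom ⟨⟨a.toIntLinearMap, continuous_of_discreteTopology⟩,
        fun g => ContinuousLinearMap.ext fun x => ha g x⟩) f)
  rw [hΨ₂ _ χ hχ]
  congr 1
  refine Subtype.ext (ContinuousMap.ext fun g => ?_)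
  rw [hχ]
  change Θ₂ (a (f.1 (cd.conj g))) = a' (ψ.1 g)
  rw [hψ, hcomm]

/-! ## §5 Selmer transport -/

/-- **The transfer carries `H¹_𝓕(K, ρ)` into `H¹_{𝓕′}(K, ρ′)`** as soon as, at every finite place `v`,
`H¹(K_v, Θ) ∘ transport_v` maps `𝓕_{σ v}` into `𝓕′_v`, and `𝓕′` is everything at the infinite places (automatic for `K`
imaginary quadratic and odd torsion, where `H¹(K_∞, ·) = 0`).  With the symmetric hypothesis for an inverse transfer the image
is all of `H¹_{𝓕′}(K, ρ′)`.  (Howard: «we may identify `H¹_{𝓕*}(K, T*[𝔪]) ≅ H¹_𝓕(K, T[𝔪])`», proof of Thm. 1.4.2.)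
[cite: Howard2004HeegnerKolyvagin, Thm. 1.4.2 proof (arXiv:1202.6340 p0008 L120–L124) with §1.3 H.4/H.5(b) (p. 7 L69–97)] -/
theorem conjTransfer_mem_selmerGroup (cd : ConjugationDatum K) (ρ : DiscreteGaloisModule K M)
    (ρ' : DiscreteGaloisModule K M') (Θ : M →+ M')
    (hΘ : ∀ (g : absoluteGaloisGroup K) (m : M), Θ (ρ (cd.conj g) m) = ρ' g (Θ m))
    (Ψ : galoisCohomology ρ 1 →+ galoisCohomology ρ' 1)
    (hΨ : ∀ (φ : contOneCocycles ρ.toTopRep) (ψ : contOneCocycles ρ'.toTopRep),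
      (∀ g, ψ.1 g = Θ (φ.1 (cd.conj g))) → Ψ (oneCocycleClass _ φ) = oneCocycleClass _ ψ)
    (𝓕 : SelmerStructure ρ) (𝓕' : SelmerStructure ρ')
    (hfin : ∀ v : HeightOneSpectrum (𝓞 K),
      (𝓕 (Sum.inr (cd.σ • v))).map
          ((ContinuousRep.cohomologyMap ((cd.twist ρ).toLocal (Sum.inr v)) (ρ'.toLocal (Sum.inr v)) Θ
              continuous_of_discreteTopology (twist_semilinear_equivariant_toLocal cd ρ ρ' Θ hΘ (Sum.inr v)) 1).comp
            (cd.transportH1 ρ v)) ≤ 𝓕' (Sum.inr v))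
    (hinf : ∀ (w : InfinitePlace K) (x : galoisCohomology (ρ'.toLocal (Sum.inl w)) 1), x ∈ 𝓕' (Sum.inl w))
    {c : galoisCohomology ρ 1} (hc : c ∈ 𝓕.selmerGroup) : Ψ c ∈ 𝓕'.selmerGroup := by
  rw [SelmerStructure.mem_selmerGroup_iff] at hc ⊢
  rintro (w | v)
  · exact hinf w _
  · rw [conjTransfer_localization cd ρ ρ' Θ hΘ Ψ hΨ v c]
    exact hfin v ⟨_, hc (Sum.inr (cd.σ • v)), rfl⟩

end Literature.NumberTheory.GaloisCohomology.Howard2004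

end
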